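import Mathlib
import HarnessLib
import Literature.Analysis.FluidPDE.SuitableWeak
import Literature.Analysis.FluidPDE.SelfSimilar
import Literature.Analysis.FluidPDE.LocalTypeI
import Literature.Analysis.FluidPDE.SpaceTimeRescaling
import Literature.Analysis.FluidPDE.LocalTypeICongr
import Summits.NavierStokesRegularity.NavierStokesRegularity.Theorems.RellichScarApexLocalisationClassBlowupPersistence
import Summits.NavierStokesRegularity.NavierStokesRegularity.Theorems.RellichScarApexLocalisationSmallRateRegularity
import Summits.NavierStokesRegularity.NavierStokesRegularity.Theorems.RellichScarApexLocalisationConfinementImpliesApex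
import Summits.NavierStokesRegularity.NavierStokesRegularity.Theorems.RellichScarApexLocalisationCleanTrunkCompactness
import Summits.NavierStokesRegularity.NavierStokesRegularity.Theorems.RellichScarApexLocalisationFissionCertificate
import Summits.NavierStokesRegularity.NavierStokesRegularity.Theorems.RellichScarApexLocalisationFissionReductionCore
import Summits.NavierStokesRegularity.NavierStokesRegularity.Theses.RellichScar

/-!
# Crux ⇔ bet for line `activity-genealogy-fission` (route RellichScar, crux `ApexLocalisation`,
stmt-NavierStokesRegularity-11719; lead c2)

With the four known stubs of skeleton v2 in the tree — E `stub_classBlowupPersistence` (p106827),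
S1a `stub_smallRateRegularity` (p107264), S1b `stub_confinementImpliesApex` (p108091),
S2 `stub_cleanTrunkCompactness` (p108561) —, the core composition `apexLocalisation_of_fissionStubs`
(p110416) and the certificate `noPerpetualFission_of_apexLocalisation` (p106403), the registered bet
`stub_noPerpetualFission` (no perpetual fission, window form) is EXACTLY as strong as the crux:

* `apexLocalisation_of_noPerpetualFission` — bet ⇒ crux (unconditionally in the known stubs);
* `apexLocalisation_iff_noPerpetualFission` — crux ⇔ bet.
-/

-- the summit and its single sub-problem share the name (CONVENTIONS §1), as in every Theorems file
set_option linter.dupNamespace false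

namespace Summit.NavierStokesRegularity.NavierStokesRegularity.Theorems.RellichScarApexLocalisation

open MeasureTheory Set Function Metric Filter Topology TopologicalSpace
open scoped ENNReal NNReal
open Literature.Analysis Literature.Analysis.FluidPDE

/-- **The bet implies the crux** (composition of the line `activity-genealogy-fission` with the four landed
known stubs): `apexLocalisation_of_fissionStubs` fed with S1b (itself fed with E and S1a) and S2. -/
theorem apexLocalisation_of_noPerpetualFission
    (hT : ∀ C : ℝ, (∃ (u : ℝ → (EuclideanSpace ℝ (Fin 3)) → (EuclideanSpace ℝ (Fin 3))) (p : ℝ → (EuclideanSpace ℝ (Fin 3)) → ℝ) (G : ℝ → (EuclideanSpace ℝ (Fin 3)) → (EuclideanSpace ℝ (Fin 3)) →L[ℝ] (EuclideanSpace ℝ (Fin 3))), IsSuitableWeakSolutionOn (slab (EuclideanSpace ℝ (Fin 3)) (Iio 0) isOpen_Iio) 1 0 u p ∧ HasWeakSpatialGradientOn (slab (EuclideanSpace ℝ (Fin 3)) (Iio 0) isOpen_Iio) u G ∧ typeIBound (Set.Iio (0 : ℝ) ×ˢ Set.univ) u p G < ⊤ ∧ HasTypeITimeDecay C u ∧ IsBackwardSingularPoint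 u 0) → ∃ (C₁ : ℝ) (I₁ : ℝ≥0∞), I₁ < ⊤ ∧ ∀ η : ℝ, 0 < η → ∃ R : ℝ, 0 < R ∧ ∀ ε : ℝ, 0 < ε → ∃ (u : ℝ → (EuclideanSpace ℝ (Fin 3)) → (EuclideanSpace ℝ (Fin 3))) (p : ℝ → (EuclideanSpace ℝ (Fin 3)) → ℝ) (G : ℝ → (EuclideanSpace ℝ (Fin 3)) → (EuclideanSpace ℝ (Fin 3)) →L[ℝ] (EuclideanSpace ℝ (Fin 3))), IsSuitableWeakSolutionOn (slab (EuclideanSpace ℝ (Fin 3)) (Iio 0) isOpen_Iio) 1 0 u p ∧ HasWeakSpatialGradientOn (slab (EuclideanSpace ℝ (Fin 3)) (Iio 0) isOpen_Iio) u G ∧ typeIBound (Iio (0 : ℝ) ×ˢ univ) u p G ≤ I₁ ∧ HasTypeITimeDecay C₁ u ∧ ContinuousOn (uncurry u) (Iio (0 : ℝ) ×ˢ univ) ∧ IsBackwardSingularPoint u 0 ∧ ∀ t : ℝ, t < 0 → ∀ x : (EuclideanSpace ℝ (Fin 3)), ε ≤ ‖x‖ + Real.sqrt (-t) → ‖x‖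 + Real.sqrt (-t) ≤ ε⁻¹ → R * Real.sqrt (-t) ≤ ‖x‖ → Real.sqrt (-t) * ‖u t x‖ ≤ η) :
    Summit.NavierStokesRegularity.NavierStokesRegularity.Theses.RellichScar.ApexLocalisation :=
  apexLocalisation_of_fissionStubs
    (stub_confinementImpliesApex stub_classBlowupPersistence stub_smallRateRegularity)
    stub_cleanTrunkCompactness hT

/-- **Crux ⇔ bet**: with the four known stubs in the tree, the registered bet `stub_noPerpetualFission`
(no perpetual fission, window form) is EXACTLY as strong as the crux `RellichScar.ApexLocalisation`
(⇒ is the landed certificate `noPerpetualFission_of_apexLocalisation`). -/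
theorem apexLocalisation_iff_noPerpetualFission :
    Summit.NavierStokesRegularity.NavierStokesRegularity.Theses.RellichScar.ApexLocalisation ↔
    (∀ C : ℝ, (∃ (u : ℝ → (EuclideanSpace ℝ (Fin 3)) → (EuclideanSpace ℝ (Fin 3))) (p : ℝ → (EuclideanSpace ℝ (Fin 3)) → ℝ) (G : ℝ → (EuclideanSpace ℝ (Fin 3)) → (EuclideanSpace ℝ (Fin 3)) →L[ℝ] (EuclideanSpace ℝ (Fin 3))), IsSuitableWeakSolutionOn (slab (EuclideanSpace ℝ (Fin 3)) (Iio 0) isOpen_Iio) 1 0 u p ∧ HasWeakSpatialGradientOn (slab (EuclideanSpace ℝ (Fin 3)) (Iio 0) isOpen_Iio) u G ∧ typeIBound (Set.Iio (0 : ℝ) ×ˢ Set.univ) u p G < ⊤ ∧ HasTypeITimeDecay C u ∧ IsBackwardSingularPoint u 0) → ∃ (C₁ : ℝ) (I₁ : ℝ≥0∞), I₁ < ⊤ ∧ ∀ η : ℝ, 0 < η → ∃ R : ℝ, 0 < R ∧ ∀ ε : ℝ, 0 < ε → ∃ (u : ℝ → (EuclideanSpace ℝ (Fin 3)) → (EuclideanSpace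 ℝ (Fin 3))) (p : ℝ → (EuclideanSpace ℝ (Fin 3)) → ℝ) (G : ℝ → (EuclideanSpace ℝ (Fin 3)) → (EuclideanSpace ℝ (Fin 3)) →L[ℝ] (EuclideanSpace ℝ (Fin 3))), IsSuitableWeakSolutionOn (slab (EuclideanSpace ℝ (Fin 3)) (Iio 0) isOpen_Iio) 1 0 u p ∧ HasWeakSpatialGradientOn (slab (EuclideanSpace ℝ (Fin 3)) (Iio 0) isOpen_Iio) u G ∧ typeIBound (Iio (0 : ℝ) ×ˢ univ) u p G ≤ I₁ ∧ HasTypeITimeDecay C₁ u ∧ ContinuousOn (uncurry u) (Iio (0 : ℝ) ×ˢ univ) ∧ IsBackwardSingularPoint u 0 ∧ ∀ t : ℝ, t < 0 → ∀ x : (EuclideanSpace ℝ (Fin 3)), ε ≤ ‖x‖ + Real.sqrt (-t) → ‖x‖ + Real.sqrt (-t) ≤ ε⁻¹ → R * Real.sqrt (-t) ≤ ‖x‖ → Real.sqrt (-t) * ‖u t x‖ ≤ η) :=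
  ⟨noPerpetualFission_of_apexLocalisation, apexLocalisation_of_noPerpetualFission⟩

end Summit.NavierStokesRegularity.NavierStokesRegularity.Theorems.RellichScarApexLocalisation
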